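import Mathlib
import Summits.ValiantsHypothesis.ValiantsHypothesis.Theorems.LacunarySymmetroidMatrixDescartesDetLorentzianHessianDefinite

/-!
# ValiantsHypothesis / LacunarySymmetroid — crux `MatrixDescartes` (stmt-ValiantsHypothesis-18050), line
# `lorentzian_shadow` :: `stub_detLorentzian`: [L5] the SEMIDEFINITE-FROM-DEFINITE LIMIT for clause (d), all `m, K`

Helper file (`--supports stmt-ValiantsHypothesis-18050 --as helper`; cell val-lit, seat val-lit-p5 g9, merged desk
RULINGS #95/#98 [L5]).  Closes NO item; theorem-only, 0 facts.  «V1 line helper; `MatrixDescartes` / Conjecture B /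
`VP ≠ VNP` OPEN.»

Clause (d) of `IsLorentzianArray m K (detArray m K A)` (every Hessian block `hessAt (detArray m K A) γ`,
`|γ| = m − 2`, has at most one positive eigenvalue) was proved for positive DEFINITE tuples by p6 g12 (heir of p4's
campaign): `DetLorentzianHessianDefinite.atMostOnePosEig_hessAt_detArray_of_posDef` (Gårding–Rolle along a word,
tree library `Literature/AlgebraicGeometry/HyperbolicPolynomials/*`).  This file passes to positive SEMIdefinite
tuples — the stub's hypothesis — by the limit `A_l + ε·1 → A_l`:

* `tendsto_dotProduct_mulVec` / **`atMostOnePosEig_of_tendsto`** — the line's `AtMostOnePosEig` (unfolded) is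
  preserved under entrywise limits along `𝓝[>] 0` (its hypothesis `0 < vᵀHv` is open, its conclusion closed);
* **`coeff_det_pencil_add_smul_continuous`** — every coefficient of `det (Σ_l s_l (A_l + ε E_l))` is polynomial,
  hence continuous, in `ε` (evaluate `det` over `(MvPolynomial (Fin K) ℝ)[Y]` at `Y = C ε`);
* `posDef_add_smul_one` — `A ⪰ 0`, `ε > 0` ⇒ `A + ε·1 ≻ 0`;
* **`atMostOnePosEig_hessAt_detArray_of_posSemidef`** — CLAUSE (d) for all `m, K` and positive SEMIDEFINITE
  tuples, in the line's unfolded currency (same token shape as p6's definite statement).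

The assembly `isLorentzianArray_detArray_of_posSemidef` (= `stub_detLorentzian` verbatim) is the separate file
`…StubDetLorentzian.lean`.
-/

set_option linter.dupNamespace false

namespace Summit.ValiantsHypothesis.ValiantsHypothesis.Theorems.LacunarySymmetroidMatrixDescartes

open Polynomial Matrix Finset Filter Topology

namespace DetLorentzianLimit

variable {K m : ℕ}

/-! ## 1. `AtMostOnePosEig` passes to entrywise limits -/

/-- Bilinear forms `vᵀ H_ε w` converge when the entries do. -/
theorem tendsto_dotProduct_mulVec {F : Filter ℝ} (H : ℝ → Matrix (Fin K) (Fin K) ℝ) (H₀ : Matrix (Fin K) (Fin K) ℝ)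
    (hH : ∀ i j, Tendsto (fun ε => H ε i j) F (𝓝 (H₀ i j))) (v w : Fin K → ℝ) :
    Tendsto (fun ε => v ⬝ᵥ (H ε *ᵥ w)) F (𝓝 (v ⬝ᵥ (H₀ *ᵥ w))) := by
  simp only [dotProduct, Matrix.mulVec]
  refine tendsto_finsetSum _ fun i _ => ?_
  refine Tendsto.mul tendsto_const_nhds ?_
  exact tendsto_finsetSum _ fun j _ => (hH i j).mul tendsto_const_nhds

/-- **`AtMostOnePosEig` is preserved under entrywise limits** along a nontrivial filter: if every `H_ε` satisfies
the line's reverse Cauchy–Schwarz condition, so does the limit. -/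
theorem atMostOnePosEig_of_tendsto {F : Filter ℝ} [NeBot F] (H : ℝ → Matrix (Fin K) (Fin K) ℝ)
    (H₀ : Matrix (Fin K) (Fin K) ℝ) (hH : ∀ i j, Tendsto (fun ε => H ε i j) F (𝓝 (H₀ i j)))
    (hε : ∀ᶠ ε in F, ∀ v w : Fin K → ℝ, 0 < v ⬝ᵥ (H ε *ᵥ v) →
      (v ⬝ᵥ (H ε *ᵥ v)) * (w ⬝ᵥ (H ε *ᵥ w)) ≤ (v ⬝ᵥ (H ε *ᵥ w)) ^ 2) :
    ∀ v w : Fin K → ℝ, 0 < v ⬝ᵥ (H₀ *ᵥ v) →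
      (v ⬝ᵥ (H₀ *ᵥ v)) * (w ⬝ᵥ (H₀ *ᵥ w)) ≤ (v ⬝ᵥ (H₀ *ᵥ w)) ^ 2 := by
  intro v w hv
  have hvv := tendsto_dotProduct_mulVec H H₀ hH v v
  have hww := tendsto_dotProduct_mulVec H H₀ hH w w
  have hvw := tendsto_dotProduct_mulVec H H₀ hH v w
  have hpos : ∀ᶠ ε in F, 0 < v ⬝ᵥ (H ε *ᵥ v) := hvv.eventually (lt_mem_nhds hv)
  refine le_of_tendsto_of_tendsto (hvv.mul hww) (hvw.pow 2) ?_
  filter_upwards [hε, hpos] with ε h1 h2 using h1 v w h2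

/-! ## 2. Coefficients of the perturbed pencil determinant are polynomial in `ε` -/

/-- The perturbed pencil determinant is the evaluation at `Y = C ε` of a fixed polynomial over
`MvPolynomial (Fin K) ℝ`. -/
theorem det_pencil_add_smul_eq_eval (A E : Fin K → Matrix (Fin m) (Fin m) ℝ) (ε : ℝ) :
    Matrix.det (∑ l, (MvPolynomial.X l : MvPolynomial (Fin K) ℝ) • (A l + ε • E l).map MvPolynomial.C) =
      (Matrix.det ((∑ l, (MvPolynomial.X l : MvPolynomial (Fin K) ℝ) • (A l).map MvPolynomial.C).map
            (Polynomial.C : MvPolynomial (Fin K) ℝ →+* (MvPolynomial (Fin K) ℝ)[X]) +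
          (Polynomial.X : (MvPolynomial (Fin K) ℝ)[X]) •
            (∑ l, (MvPolynomial.X l : MvPolynomial (Fin K) ℝ) • (E l).map MvPolynomial.C).map
              (Polynomial.C : MvPolynomial (Fin K) ℝ →+* (MvPolynomial (Fin K) ℝ)[X]))).eval
        (MvPolynomial.C ε) := by
  rw [← Polynomial.coe_evalRingHom, RingHom.map_det]
  congr 1
  refine Matrix.ext fun i j => ?_
  simp only [RingHom.mapMatrix_apply, Matrix.map_apply, Matrix.add_apply, Matrix.smul_apply, Matrix.sum_apply,
    smul_eq_mul, Polynomial.coe_evalRingHom, eval_mul, eval_C, eval_X, map_sum, map_mul, map_add,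
    Polynomial.eval_finsetSum, Finset.mul_sum, ← Finset.sum_add_distrib]
  exact Finset.sum_congr rfl fun l _ => by ring

/-- **Every coefficient of `det (Σ_l s_l (A_l + ε E_l))` is continuous (indeed polynomial) in `ε`.** -/
theorem coeff_det_pencil_add_smul_continuous (A E : Fin K → Matrix (Fin m) (Fin m) ℝ) (d : Fin K →₀ ℕ) :
    Continuous fun ε : ℝ => MvPolynomial.coeff d
      (Matrix.det (∑ l, (MvPolynomial.X l : MvPolynomial (Fin K) ℝ) • (A l + ε • E l).map MvPolynomial.C)) := by
  set D := Matrix.det ((∑ l, (MvPolynomial.X l : MvPolynomial (Fin K) ℝ) • (A l).map MvPolynomial.C).map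
      (Polynomial.C : MvPolynomial (Fin K) ℝ →+* (MvPolynomial (Fin K) ℝ)[X]) +
    (Polynomial.X : (MvPolynomial (Fin K) ℝ)[X]) •
      (∑ l, (MvPolynomial.X l : MvPolynomial (Fin K) ℝ) • (E l).map MvPolynomial.C).map
        (Polynomial.C : MvPolynomial (Fin K) ℝ →+* (MvPolynomial (Fin K) ℝ)[X])) with hD
  have hfun : (fun ε : ℝ => MvPolynomial.coeff d
      (Matrix.det (∑ l, (MvPolynomial.X l : MvPolynomial (Fin K) ℝ) • (A l + ε • E l).map MvPolynomial.C))) =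
      fun ε : ℝ => ∑ i ∈ Finset.range (D.natDegree + 1), MvPolynomial.coeff d (D.coeff i) * ε ^ i := by
    funext ε
    rw [det_pencil_add_smul_eq_eval, ← hD, eval_eq_sum_range, MvPolynomial.coeff_sum]
    refine Finset.sum_congr rfl fun i _ => ?_
    rw [← map_pow, mul_comm, MvPolynomial.coeff_C_mul, mul_comm]
  rw [hfun]
  exact continuous_finsetSum _ fun i _ => continuous_const.mul (continuous_pow i)

/-! ## 3. Definite perturbations of semidefinite matrices -/

/-- `A ⪰ 0` and `ε > 0` give `A + ε·1 ≻ 0`. -/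
theorem posDef_add_smul_one (A : Matrix (Fin m) (Fin m) ℝ) (hA : A.PosSemidef) {ε : ℝ} (hε : 0 < ε) :
    (A + ε • (1 : Matrix (Fin m) (Fin m) ℝ)).PosDef := by
  refine Matrix.PosDef.posSemidef_add hA ?_
  rw [show ε • (1 : Matrix (Fin m) (Fin m) ℝ) = Matrix.diagonal fun _ => ε by
    ext p q; by_cases hpq : p = q <;> simp [hpq]]
  exact Matrix.posDef_diagonal_iff.mpr fun _ => hε

/-! ## 4. Clause (d) for positive semidefinite tuples -/

/-- **Clause (d) of `IsLorentzianArray m K (detArray m K A)` for positive SEMIDEFINITE tuples** (the stub's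
hypothesis), all `m, K`, in the line's unfolded currency: every Hessian block `hessAt (detArray m K A) γ` with
`|γ| = m − 2` has at most one positive eigenvalue.  [Limit `A_l + ε·1 → A_l` of p6's definite theorem.] -/
theorem atMostOnePosEig_hessAt_detArray_of_posSemidef (m K : ℕ) (A : Fin K → Matrix (Fin m) (Fin m) ℝ)
    (hA : ∀ l, (A l).PosSemidef) :
    ∀ γ ∈ (Fintype.piFinset fun _ : Fin K => Finset.range (m - 2 + 1)).filter (fun α => ∑ i, α i = m - 2),
      ∀ v w : Fin K → ℝ,
        0 < v ⬝ᵥ ((fun i j : Fin K =>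
              ((∏ k, ((γ + Pi.single i 1 + Pi.single j 1 : Fin K → ℕ) k).factorial : ℕ) : ℝ) *
                MvPolynomial.coeff (Finsupp.equivFunOnFinite.symm (γ + Pi.single i 1 + Pi.single j 1))
                  (Matrix.det (∑ l, (MvPolynomial.X l : MvPolynomial (Fin K) ℝ) • (A l).map MvPolynomial.C)))
            *ᵥ v) →
          (v ⬝ᵥ ((fun i j : Fin K =>
              ((∏ k, ((γ + Pi.single i 1 + Pi.single j 1 : Fin K → ℕ) k).factorial : ℕ) : ℝ) *
                MvPolynomial.coeff (Finsupp.equivFunOnFinite.symm (γ + Pi.single i 1 + Pi.single j 1))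
                  (Matrix.det (∑ l, (MvPolynomial.X l : MvPolynomial (Fin K) ℝ) • (A l).map MvPolynomial.C)))
            *ᵥ v)) *
            (w ⬝ᵥ ((fun i j : Fin K =>
              ((∏ k, ((γ + Pi.single i 1 + Pi.single j 1 : Fin K → ℕ) k).factorial : ℕ) : ℝ) *
                MvPolynomial.coeff (Finsupp.equivFunOnFinite.symm (γ + Pi.single i 1 + Pi.single j 1))
                  (Matrix.det (∑ l, (MvPolynomial.X l : MvPolynomial (Fin K) ℝ) • (A l).map MvPolynomial.C)))
            *ᵥ w)) ≤
          (v ⬝ᵥ ((fun i j : Fin K =>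
              ((∏ k, ((γ + Pi.single i 1 + Pi.single j 1 : Fin K → ℕ) k).factorial : ℕ) : ℝ) *
                MvPolynomial.coeff (Finsupp.equivFunOnFinite.symm (γ + Pi.single i 1 + Pi.single j 1))
                  (Matrix.det (∑ l, (MvPolynomial.X l : MvPolynomial (Fin K) ℝ) • (A l).map MvPolynomial.C)))
            *ᵥ w)) ^ 2 := by
  classical
  intro γ hγ
  -- the perturbed definite tuples and their Hessian blocks
  set Aε : ℝ → Fin K → Matrix (Fin m) (Fin m) ℝ := fun ε l => A l + ε • (1 : Matrix (Fin m) (Fin m) ℝ) with hAε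
  set Hε : ℝ → Matrix (Fin K) (Fin K) ℝ := fun ε i j =>
    ((∏ k, ((γ + Pi.single i 1 + Pi.single j 1 : Fin K → ℕ) k).factorial : ℕ) : ℝ) *
      MvPolynomial.coeff (Finsupp.equivFunOnFinite.symm (γ + Pi.single i 1 + Pi.single j 1))
        (Matrix.det (∑ l, (MvPolynomial.X l : MvPolynomial (Fin K) ℝ) • (Aε ε l).map MvPolynomial.C)) with hHε
  have hA0 : Aε 0 = A := by funext l; simp [hAε]
  have hH0 : (fun i j : Fin K =>
      ((∏ k, ((γ + Pi.single i 1 + Pi.single j 1 : Fin K → ℕ) k).factorial : ℕ) : ℝ) *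
        MvPolynomial.coeff (Finsupp.equivFunOnFinite.symm (γ + Pi.single i 1 + Pi.single j 1))
          (Matrix.det (∑ l, (MvPolynomial.X l : MvPolynomial (Fin K) ℝ) • (A l).map MvPolynomial.C))) = Hε 0 := by
    funext i j; simp only [hHε, hA0]
  rw [hH0]
  -- entrywise continuity of Hε
  have hcont : ∀ i j, Tendsto (fun ε => Hε ε i j) (𝓝[>] (0 : ℝ)) (𝓝 (Hε 0 i j)) := by
    intro i j
    have hc : Continuous fun ε => Hε ε i j := by
      simp only [hHε, hAε]
      exact continuous_const.mul (coeff_det_pencil_add_smul_continuous A (fun _ => 1) _)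
    exact (hc.tendsto 0).mono_left nhdsWithin_le_nhds
  -- the definite theorem along ε > 0
  have hev : ∀ᶠ ε in 𝓝[>] (0 : ℝ), ∀ v w : Fin K → ℝ, 0 < v ⬝ᵥ (Hε ε *ᵥ v) →
      (v ⬝ᵥ (Hε ε *ᵥ v)) * (w ⬝ᵥ (Hε ε *ᵥ w)) ≤ (v ⬝ᵥ (Hε ε *ᵥ w)) ^ 2 := by
    refine eventually_nhdsWithin_of_forall fun ε (hε : 0 < ε) => ?_
    have hPD : ∀ l, (Aε ε l).PosDef := fun l => posDef_add_smul_one (A l) (hA l) hε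
    exact DetLorentzianHessianDefinite.atMostOnePosEig_hessAt_detArray_of_posDef m K (Aε ε) hPD γ hγ
  exact atMostOnePosEig_of_tendsto Hε (Hε 0) hcont hev

end DetLorentzianLimit

end Summit.ValiantsHypothesis.ValiantsHypothesis.Theorems.LacunarySymmetroidMatrixDescartes
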